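import Summits.Ventures.Crystal3D.Theorems.StickyWulffConstantTextureLiminfCubeRigidityLocalStacking
import HarnessLib

/-!
# Cube rigidity III — LOCAL no-room and the LOCAL form of Hales's *Dense Sphere Packings* §1.3
# (lane T, crux `TextureLiminf`, stmt-Ventures-19483; registered line `TexShadow`, named core `CubeRigidity` of `stub_resolution`)

HONEST FRAMING. Venture `Summits/Ventures/Crystal3D` (cell `crystal3d-full`), helper `--supports` the crux `TextureLiminf`
(stmt-Ventures-19483) of `route-Ventures-StickyWulffConstant`, registered line `TexShadow`.  Rung credit only; F-C1 not moved.
Third brick of the kernel proof of `CubeRigidity` (Hales's normalisation, frame `u₁ u₂ w h e₃` of `LayerShells.lean`).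

* `exists_site_near` — LOCAL NO-ROOM: every point `x` of `ℝ³` is within distance `< 2` of a site `(k, i, j)` of any close-packed
  stacking with `|k| ≤ ‖x‖ + 2` and `|i| + |j| ≤ 4(‖x‖ + 2)` (`exists_dist_barlowPos_lt_two` + coordinate bounds, `|haggLabel s k| ≤ |k|`).
* `local_layerPackings` — LOCAL HALES §1.3: if the origin's layer is present to ℓ¹-radius `n` with layer shells and every centre
  within `2n + 2` has an FCC/HCP tangent arrangement, then every centre within `R`, `6(R + 2) ≤ n`, is a point of ONE close-packed
  stacking `barlowStacking 2 h s` (`exists_local_stacking` + no-room + the packing condition).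
* `local_layerPackings_hcp` — the same from an HCP-type centre at the origin in its frame (base layer by `layerDisc_hcp`), with
  FCC/HCP arrangements within `12R + 28`; `local_layerPackings_fcc` — the same from a centre whose shell contains the standard
  hexagon, with FCC arrangements within `12R + 28` (base layer by `layerDisc_fcc`).
WHAT THIS IS NOT: not yet `CubeRigidity` (file IV: frames at a ball of a finite packing, the case split, the doubling bridge);
F-C1 not moved.
-/

noncomputable section

namespace Summit.Ventures.Crystal3D.Theorems.LocalStacking

open Literature.Geometry.DiscreteGeometry Literature.MathematicalPhysics.StatisticalMechanics
open RealInnerProductSpace Summit.Ventures.Crystal3D.L2B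

variable {V : Set (EuclideanSpace ℝ (Fin 3))}

/-! ## Local no-room -/

/-- `1 ≤ h` (`h² = 8/3`). -/
theorem one_le_layerSpacing : (1 : ℝ) ≤ layerSpacing := by
  nlinarith [layerSpacing_sq, layerSpacing_pos]

/-- **Local no-room.** Every point of `ℝ³` is within distance `< 2` of a site of the close-packed stacking of any Hägg word,
and that site has level `|k| ≤ ‖x‖ + 2` and in-layer index `|i| + |j| ≤ 4(‖x‖ + 2)`. -/
theorem exists_site_near {s : ℤ → ℤ} (hs : IsHaggSeq s) (x : EuclideanSpace ℝ (Fin 3)) :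
    ∃ k i j : ℤ, dist x (barlowPos 2 layerSpacing s k i j) < 2 ∧
      ((|k| : ℤ) : ℝ) ≤ ‖x‖ + 2 ∧ ((|i| + |j| : ℤ) : ℝ) ≤ 4 * (‖x‖ + 2) := by
  obtain ⟨k, i, j, hd⟩ := exists_dist_barlowPos_lt_two s x
  refine ⟨k, i, j, hd, ?_⟩
  set p := barlowPos 2 layerSpacing s k i j with hp
  set L : ℝ := (haggLabel s k : ℝ) with hLdef
  -- `‖p‖ ≤ ‖x‖ + 2`
  have hpn : ‖p‖ ≤ ‖x‖ + 2 := by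
    have h1 : ‖p‖ ≤ ‖x‖ + ‖p - x‖ := norm_le_insert' p x
    have h2 : ‖p - x‖ < 2 := by rw [← dist_eq_norm, dist_comm]; exact hd
    linarith
  set R' : ℝ := ‖x‖ + 2 with hR'
  have hR'0 : 0 ≤ R' := by positivity
  -- coordinates
  have c0 : |(2 : ℝ) * (i + j / 2 + L / 2)| ≤ R' := by
    have := PiLp.norm_apply_le p 0
    rw [Real.norm_eq_abs, hp, barlowPos_apply_zero] at this
    exact this.trans hpn
  have c1 : |(2 : ℝ) * Real.sqrt 3 / 2 * (j + L / 3)| ≤ R' := by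
    have := PiLp.norm_apply_le p 1
    rw [Real.norm_eq_abs, hp, barlowPos_apply_one] at this
    exact this.trans hpn
  have c2 : |(k : ℝ) * layerSpacing| ≤ R' := by
    have := PiLp.norm_apply_le p 2
    rw [Real.norm_eq_abs, hp, barlowPos_apply_two] at this
    exact this.trans hpn
  -- `|k| ≤ R'`
  have hk : |(k : ℝ)| ≤ R' := by
    rw [abs_mul, abs_of_pos layerSpacing_pos] at c2
    nlinarith [one_le_layerSpacing, abs_nonneg (k : ℝ)]
  -- `|L| ≤ |k|`
  have hL : |L| ≤ |(k : ℝ)| := by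
    rw [hLdef, ← Int.cast_abs, ← Int.cast_abs]; exact_mod_cast abs_haggLabel_le hs k
  -- `|j + L/3| ≤ R'`
  have hj3 : |(j : ℝ) + L / 3| ≤ R' := by
    have hs3 : (1 : ℝ) ≤ Real.sqrt 3 := by
      rw [show (1 : ℝ) = Real.sqrt 1 by simp]; exact Real.sqrt_le_sqrt (by norm_num)
    have e : (2 : ℝ) * Real.sqrt 3 / 2 * (j + L / 3) = Real.sqrt 3 * (j + L / 3) := by ring
    rw [e, abs_mul, abs_of_pos (by positivity : (0 : ℝ) < Real.sqrt 3)] at c1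
    nlinarith [abs_nonneg ((j : ℝ) + L / 3)]
  have e0 : (2 : ℝ) * (i + j / 2 + L / 2) = 2 * i + j + L := by ring
  rw [e0] at c0
  obtain ⟨a1, a2⟩ := abs_le.1 c0
  obtain ⟨b1, b2⟩ := abs_le.1 hj3
  obtain ⟨d1, d2⟩ := abs_le.1 (hL.trans hk)
  have hj : |(j : ℝ)| ≤ 4 / 3 * R' := abs_le.2 ⟨by linarith, by linarith⟩
  obtain ⟨f1, f2⟩ := abs_le.1 hj
  have hi : |(i : ℝ)| ≤ 5 / 3 * R' := abs_le.2 ⟨by linarith, by linarith⟩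
  constructor
  · push_cast; exact hk
  · push_cast; linarith

/-! ## Local Hales §1.3 -/

/-- **Local form of Hales, *Dense Sphere Packings* §1.3.** In a packing of unit balls, if the origin's layer is present to
ℓ¹-radius `n` with layer shells `layerShell σ σ'` and every centre within `2n + 2` of the origin has an FCC or HCP tangent
arrangement, then for one Hägg word `s` every centre within `R` of the origin (`6(R + 2) ≤ n`) is a point of the close-packed
stacking `barlowStacking 2 h s`. -/
theorem local_layerPackings (hV : IsUnitBallPacking V) {σ σ' : ℝ} (hσ : σ = 1 ∨ σ = -1) (hσ' : σ' = 1 ∨ σ' = -1)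
    {n : ℤ} (hL : LayerDisc V 0 σ σ' n)
    (hcp : ∀ u ∈ V, ‖u‖ ≤ 2 * n + 2 → IsArrangedIn (kissingShell V u) fccKissingPattern ∨
      IsArrangedIn (kissingShell V u) hcpKissingPattern)
    {R : ℝ} (hR : 6 * (R + 2) ≤ n) :
    ∃ s : ℤ → ℤ, IsHaggSeq s ∧ ∀ u ∈ V, ‖u‖ ≤ R → u ∈ barlowStacking 2 layerSpacing s := by
  obtain ⟨s, hs, hsite⟩ := exists_local_stacking hV hσ hσ' hL hcp
  refine ⟨s, hs, fun u hu huR => ?_⟩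
  obtain ⟨k, i, j, hd, hk, hij⟩ := exists_site_near hs u
  have hbudget : |i| + |j| ≤ n - 2 * |k| := by
    have : ((|i| + |j| : ℤ) : ℝ) ≤ ((n - 2 * |k| : ℤ) : ℝ) := by push_cast at hk hij ⊢; linarith
    exact_mod_cast this
  have hmem : barlowPos 2 layerSpacing s k i j ∈ V := hsite k i j hbudget
  rw [hV hu hmem hd]
  exact barlowPos_mem _ _ _

/-- **Local §1.3 from an HCP-type centre** (in its frame): if `0 ∈ V` has shell `layerShell s₀ s₀` and every centre within
`12R + 28` has an FCC or HCP tangent arrangement, then every centre within `R` is a point of one close-packed stacking. -/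
theorem local_layerPackings_hcp (hV : IsUnitBallPacking V) (h0 : (0 : EuclideanSpace ℝ (Fin 3)) ∈ V) {s₀ : ℝ}
    (hs₀ : s₀ = 1 ∨ s₀ = -1) (hS0 : kissingShell V 0 = layerShell s₀ s₀) {R : ℝ}
    (hcp : ∀ u ∈ V, ‖u‖ ≤ 12 * R + 28 → IsArrangedIn (kissingShell V u) fccKissingPattern ∨
      IsArrangedIn (kissingShell V u) hcpKissingPattern) :
    ∃ s : ℤ → ℤ, IsHaggSeq s ∧ ∀ u ∈ V, ‖u‖ ≤ R → u ∈ barlowStacking 2 layerSpacing s := by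
  set n : ℤ := ⌈6 * (R + 2)⌉ with hn
  have hn1 : (6 * (R + 2) : ℝ) ≤ n := Int.le_ceil _
  have hn2 : (n : ℝ) < 6 * (R + 2) + 1 := Int.ceil_lt_add_one _
  have hcp' : ∀ u ∈ V, ‖u‖ ≤ 2 * n + 2 → IsArrangedIn (kissingShell V u) fccKissingPattern ∨
      IsArrangedIn (kissingShell V u) hcpKissingPattern := fun u hu h => hcp u hu (by linarith)
  exact local_layerPackings hV hs₀ hs₀ (layerDisc_hcp hV h0 hs₀ hS0 n hcp') hcp' hn1

/-- **Local §1.3 in an all-FCC ball** (in a frame): if `0 ∈ V`, the shell of `0` contains the standard hexagon, and every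
centre within `12R + 28` has an FCC tangent arrangement, then every centre within `R` is a point of one close-packed
stacking. -/
theorem local_layerPackings_fcc (hV : IsUnitBallPacking V) (h0 : (0 : EuclideanSpace ℝ (Fin 3)) ∈ V)
    (hH : hexagonSet ⊆ kissingShell V 0) {R : ℝ} (hR : 0 ≤ R)
    (hfcc : ∀ u ∈ V, ‖u‖ ≤ 12 * R + 28 → IsArrangedIn (kissingShell V u) fccKissingPattern) :
    ∃ s : ℤ → ℤ, IsHaggSeq s ∧ ∀ u ∈ V, ‖u‖ ≤ R → u ∈ barlowStacking 2 layerSpacing s := by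
  set n : ℤ := ⌈6 * (R + 2)⌉ with hn
  have hn1 : (6 * (R + 2) : ℝ) ≤ n := Int.le_ceil _
  have hn2 : (n : ℝ) < 6 * (R + 2) + 1 := Int.ceil_lt_add_one _
  have hfcc' : ∀ u ∈ V, ‖u‖ ≤ 2 * n + 2 → IsArrangedIn (kissingShell V u) fccKissingPattern :=
    fun u hu h => hfcc u hu (by linarith)
  have hcp' : ∀ u ∈ V, ‖u‖ ≤ 2 * n + 2 → IsArrangedIn (kissingShell V u) fccKissingPattern ∨
      IsArrangedIn (kissingShell V u) hcpKissingPattern := fun u hu h => Or.inl (hfcc' u hu h)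
  obtain ⟨σ, σ', hσ, hσ', hS0⟩ :=
    (isTwelveConfig_kissingShell_of_isArrangedIn hV (Or.inl (hfcc 0 h0 (by simp; positivity)))).eq_layerShell hH
  exact local_layerPackings hV hσ hσ' (layerDisc_fcc hV h0 hσ hσ' hS0 n hfcc') hcp' hn1

end Summit.Ventures.Crystal3D.Theorems.LocalStacking

end
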